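import Summits.BirchSwinnertonDyer.BirchSwinnertonDyer.Theses.CyclotomicUntwist
import Summits.BirchSwinnertonDyer.BirchSwinnertonDyer.Theses.SemiOrdinaryEisensteinDescent
import Summits.BirchSwinnertonDyer.BirchSwinnertonDyer.Theorems.WildThreeRankOneBSDpOfExactIndexManin
import Summits.BirchSwinnertonDyer.BirchSwinnertonDyer.Theorems.SchneiderFreeAdditiveX3UpperReceptacle
import Summits.BirchSwinnertonDyer.BirchSwinnertonDyer.Theorems.ClassRecordThreeStepLOfHalvesB
import Literature.NumberTheory.EllipticCurves.BSDHeegnerPointsGrossZagierProofs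
import Literature.NumberTheory.EllipticCurves.KrizLi2019.SexticTwistBSDThreeDescent
import Literature.NumberTheory.EllipticCurves.GlobalMinimalModelProofs
import Literature.NumberTheory.EllipticCurves.ModularCurveManinConstantProofs
import HarnessLib

/-!
# Route `CyclotomicUntwist`, deciding crux K1 `PSRankOneLowerHalfAtThree` (stmt-BirchSwinnertonDyer-21580) BY NAME
# from the cruxes of route `SemiOrdinaryEisensteinDescent`: Eisenstein inclusion E + Waldspurger unit value V +
# control C + rank-zero wild leaf Z ⟹ the Iwasawa-side LOWER half on EVERY onto wild rank-one row — with NO tower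
# split, NO Kolyvagin crux and NO non-tower residual (cross-route kernel)

Cell `bsd-wall` (W-ALL, row 2 @3), prover seat `bsd-line-cycu-p3` (g0), 2026-08-27. HONEST FRAMING: a
CONDITIONAL kernel — every crux named below is an ANTECEDENT; the file closes nothing and proves BSD₃ for
no curve; 0 definitions, 0 named facts minted, 0 `sorry`.

WHAT IT RECORDS. Route `CyclotomicUntwist` (CU) files the lower half `Typed.MissingLowerBoundAt W 3` on the
PRINCIPAL-SERIES rows of the onto wild rank-one leaf `WAllExclAddWildRankOneSurj` as its deciding crux
`PSRankOneLowerHalfAtThree` (to be supplied by the finite-slope road: untwist `g = f_E ⊗ η̄`, Kato IMC₃,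
3-adic Gross–Zagier at slope 1/2, Perrin-Riou–Colmez–Benois leading term). Route `SemiOrdinaryEisensteinDescent`
(SOED) carries on the WHOLE leaf the Eisenstein crux `WildSplitEisensteinInclusionAtThree` (E, item 20479),
`WildSplitWaldspurgerAtThree` (V, 20385), `WildSplitControlAtThree` (C, 20386) and the rank-zero wild leaf
`WildRankZeroTwistAtThree` (Z = `WAllExclAddWildRankZero`, 20387); its PROVED kernel
(`semiOrdinaryEisensteinDescent_eisensteinKernelAtThree_proof`, bed-p3 g1) assembles BSD₃ on the leaf from
these plus the Kolyvagin crux Ko and the non-tower residual NT. Reading that kernel HALF BY HALF: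

* §1 **`lowerHalf_of_eisenstein_of_waldspurger_of_control_of_rankZeroLeaf`** — for EVERY globally minimal `W`
  on `ClassO6 W 3` with `ρ̄_{E,3}` onto and `r_an = 1` (tower-surjective OR NOT): published inputs ∧ E ∧ V ∧ C
  ∧ Z ⟹ `MissingLowerBoundAt W 3`. Steps (a)–(b) of the SOED kernel verbatim (parity, Friedberg–Hoffstein with
  modulus `2`, Heegner point, Gross–Zagier, Kolyvagin's finiteness over `K`, frame `(κ, γ, 𝔭, 𝔭′)`, Waldspurger
  value at `𝔭`, control at `𝔭′`, Eisenstein inclusion ⟹ LOWER socket ⟹ STEP L `IndexLowerBoundLeAt W 3 K P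
  (v₃ c)`), then kmc g17's `Exact.jointLowerBoundAt_of_stepL_manin` (JOINT lower half over `(E, E^{d_K})`), Z
  pays `BSD₃` hence the UPPER half of a minimal model of the twist, and `Typed.missingLowerBoundAt_of_joint_of_upper`
  descends. None of E, V, C carries a tower binder, so NO tower split and NO residual NT is needed for this
  half; Ko is not needed either.
* §2 **`psRankOneLowerHalfAtThree_of_soed : PublishedInputsWildThree → WildSplitEisensteinInclusionAtThree →
  WildSplitWaldspurgerAtThree → WildSplitControlAtThree → WildRankZeroTwistAtThree → PSRankOneLowerHalfAtThree`**
  — CU's deciding crux K1 BY NAME; its principal-series binders and `¬ HasCM` are IDLE in this supply.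

PLANNER-LEVEL READING (bookkeeping, not a ruling): (i) as typed, K1 ⊆ SOED {E, V, C, Z} restricted to the PS
rows — the finite-slope road of the CU thesis is an ALTERNATIVE supply for the same decl, whose advantage
would have to be that on PS rows `π₃(f_E)` is a ramified principal series rather than supercuspidal (SOED E's
«why it might fail» is stated for supercuspidal `π₃`); (ii) for SOED: the LOWER half holds on the non-tower
rows too, so the residual NT (`WildRankOneSurjNonTowerAtThree`, BSD₃ on non-tower rows) is only consumed
for its UPPER half — see the companion file `CyclotomicUntwistPSRankOneUpperHalfAtThreeOfSOED`. BSD is not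
proved by any of this.

References: [JetchevSkinnerWan2017] §7.4.1 (arXiv:1512.06894 p. 30); [Castella2018] Thm. 2.3, §5 (5.1)–(5.3);
[GrossZagier1986] Thm. I.(6.3), (7.3), V.§2; [FriedbergHoffstein1995] Thm. B; [Gross1991] (1.1), Thm. 1.3;
[LiuZhangZhang2018] Thm 1.5.1/1.5.3; [Miller2011LMS] Def. 1.1; [Zywina2015] Prop. 1.14/1.16.
-/

noncomputable section

open scoped Classical

set_option linter.dupNamespace false
set_option autoImplicit false

namespace Summit.BirchSwinnertonDyer.BirchSwinnertonDyer.Theorems.CyclotomicUntwistOfSOED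

open WeierstrassCurve NumberField IsDedekindDomain Field
  Literature.NumberTheory.EllipticCurves
  Literature.NumberTheory.EllipticCurves.ModularForms
  Literature.NumberTheory.EllipticCurves.Rank1Residual
  Literature.NumberTheory.EllipticCurves.Rank1Residual.Typed
  Literature.NumberTheory.EllipticCurves.KrizLi2019
  Summit.BirchSwinnertonDyer.Rank1Residual
  Summit.BirchSwinnertonDyer.Rank1Residual.Additive
  Summit.BirchSwinnertonDyer.Rank1Residual.X11b
  Summit.BirchSwinnertonDyer.Rank1Residual.X11b.AcSelmer
  Summit.BirchSwinnertonDyer.Rank1Residual.X11b.Halves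
  Summit.BirchSwinnertonDyer.BirchSwinnertonDyer.Theses.SemiOrdinaryEisensteinDescent

/-! ### §0 The rank-zero wild leaf pays the UPPER half of a minimal model of the Heegner twist -/

/-- For `W` on `ClassO6 W 3` with `ρ̄_{E,3}` onto, an imaginary quadratic Heegner `K` for `N(E)` with `d_K` odd
and `L(E^{d_K},1) ≠ 0`, and any globally minimal `Wd ≅ E^{d_K}`: the twist is again a non-CM O6 row
(`classO6_twist_of_heegner`; `j(Wd) = j(W)` and onto mod `3` ⟹ no CM, Zywina) of analytic rank `0`, so the leaf
`WAllExclAddWildRankZero` (hypothesis) gives `BSDp Wd 3`, which contains `MissingUpperBoundAt Wd 3` (Miller's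
currency, `Ш(Wd)` finite by Gross–Zagier–Kolyvagin). CONDITIONAL. [cite: Zywina2015, Prop. 1.14 and Prop. 1.16]
[cite: Miller2011LMS, Def. 1.1 (arXiv:1010.2431 p. 3)] -/
theorem twist_upperHalf_of_rankZeroLeaf (hGZK : rank_eq_analyticRank_of_analyticRank_le_one)
    (hRZ : Summit.BirchSwinnertonDyer.WAllExclAddWildRankZero)
    (W : WeierstrassCurve ℚ) [W.IsElliptic] [W.IsGloballyMinimal]
    (hO6 : ClassO6 W 3) (hsurj : W.HasSurjectiveModNGaloisRep 3)
    (K : Type) [Field K] [NumberField K] (hK : IsImaginaryQuadratic K) (hodd : Odd (NumberField.discr K))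
    (hHN : SatisfiesHeegnerHypothesis (W.conductorNorm ℤ) K)
    (hLd : (W.quadraticTwist (NumberField.discr K : ℚ)).entireLFunction 1 ≠ 0)
    (Wd : WeierstrassCurve ℚ) [Wd.IsElliptic] [Wd.IsGloballyMinimal] (Cd : VariableChange ℚ)
    (hCd : Cd • W.quadraticTwist (NumberField.discr K : ℚ) = Wd) :
    MissingUpperBoundAt Wd 3 := by
  obtain ⟨hO6d, hjd⟩ := classO6_twist_of_heegner W hO6 K hK hHN hodd Wd Cd hCd
  have hCM : ¬ W.HasCM := fun hCM ↦
    W.not_hasSurjectiveModNGaloisRep_of_hasCM hCM Nat.prime_three (by decide) hsurj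
  have hCMd : ¬ Wd.HasCM := fun h ↦ hCM ((hasCM_iff_of_j_eq hjd).mp h)
  have hD0 : (NumberField.discr K : ℚ) ≠ 0 := by exact_mod_cast NumberField.discr_ne_zero K
  haveI : (W.quadraticTwist (NumberField.discr K : ℚ)).IsElliptic := W.isElliptic_quadraticTwist hD0
  have hLd1 : Wd.entireLFunction 1 ≠ 0 := by rw [← hCd, entireLFunction_smul]; exact hLd
  have hrd : Wd.analyticRank = 0 := analyticRank_eq_zero_of_entireLFunction_one_ne_zero Wd hLd1
  have hWd : BSDp Wd 3 := hRZ Wd hCMd hO6d hrd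
  haveI : Finite Wd.sha := (hGZK Wd (by omega)).2
  exact (lower_and_upper_of_missingPPartAt Wd 3 (missingPPartAt_of_bsdp Wd 3 hWd)).2

/-! ### §1 The LOWER half on every onto wild rank-one row from E, V, C and Z -/

/-- **LOWER half `ord₃ #Ш_an(E) ≤ ord₃ #Ш(E)` on EVERY onto wild rank-one row ⟸ published inputs ∧ Eisenstein
crux E ∧ Waldspurger V ∧ control C ∧ rank-zero wild leaf Z — no tower split, no Kolyvagin crux, no residual.**
For `W` globally minimal on `ClassO6 W 3` with `ρ̄_{E,3}` onto and `r_an = 1`: (a) parity (`w(E) = −1`),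
Friedberg–Hoffstein with auxiliary modulus `2` (Heegner `K` for `N(E)`, `d_K ≡ 1 (mod 8)` odd, `L(E^{d_K},1) ≠ 0`;
`3 ∣ N` split so `d_K ≠ −3`, `3 ∤ #𝓞_K^×`), Heegner point `P` non-torsion (Gross–Zagier), Kolyvagin (`rank E(K)
= 1`, `Ш(E/K)` finite), a frame `(κ, γ, 𝔭)` and the other degree-one `𝔭′ ≠ 𝔭`; (b) V at `(κ, γ, 𝔭)`: `ι′`, a BDP
frame `L` and the unit value `L(𝟙) = u·(log_𝔭 P / c)²`; C at `𝔭′`: the control count (torsion guard included);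
E at the frame: `Ch_Λ(X_(∅,0))·R₀⟦T⟧ ⊆ (L)`; the lower norm receptacle reads it as the LOWER socket at slack
`v₃(c)` and K1's link as STEP L `IndexLowerBoundLeAt W 3 K P (v₃ c)` — verbatim the SOED kernel's steps; (c)
kmc g17's `Exact.jointLowerBoundAt_of_stepL_manin` gives the JOINT lower half over `(E, E^{d_K})`, Z the UPPER
half of a minimal model of the twist (§0), and `Typed.missingLowerBoundAt_of_joint_of_upper` descends.
CONDITIONAL; closes nothing. [cite: JetchevSkinnerWan2017, §7.4.1 (arXiv:1512.06894 p. 30)]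
[cite: Castella2018, Thm. 2.3 and §5 (5.1)–(5.3)] [cite: GrossZagier1986, Thm. I.(6.3) and V.§2]
[cite: FriedbergHoffstein1995, Thm. B] [cite: Miller2011LMS, Def. 1.1 (arXiv:1010.2431 p. 3)] -/
theorem lowerHalf_of_eisenstein_of_waldspurger_of_control_of_rankZeroLeaf (hF : PublishedInputsWildThree)
    (hE : WildSplitEisensteinInclusionAtThree) (hV : WildSplitWaldspurgerAtThree)
    (hC : WildSplitControlAtThree) (hZ : WildRankZeroTwistAtThree)
    (W : WeierstrassCurve ℚ) [W.IsElliptic] [W.IsGloballyMinimal]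
    (hO6 : ClassO6 W 3) (hsurj : W.HasSurjectiveModNGaloisRep 3) (hr : W.analyticRank = 1) :
    MissingLowerBoundAt W 3 := by
  obtain ⟨hGZ, hKo, hGZK, hmod, -, -, hGZ73, hFH, hpar, hHP⟩ := hF
  haveI hN0 : NeZero (W.conductorNorm ℤ) := ⟨W.conductorNorm_pos_holds.ne'⟩
  -- (a) DATA. parity: `r_an = 1` is odd, so `w(E) = -1`
  have hw : W.rootNumber = -1 := by
    rcases W.rootNumber_eq_one_or with h | h
    · exfalso
      have heven : Even W.analyticRank := (hpar W).mpr h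
      rw [hr] at heven
      exact Nat.not_even_one heven
    · exact h
  -- Friedberg–Hoffstein with auxiliary modulus `2`: Heegner for `N(E)` and `2` split
  obtain ⟨K, _, _, hK, -, hHN, hH2, hLt⟩ := hFH W hw 2 two_ne_zero 0
  have hodd : Odd (NumberField.discr K) := by
    have h8 := Literature.SatisfiesHeegnerHypothesis.discr_emod_eight hK.1 hH2 (dvd_refl 2)
    rw [Int.odd_iff]; omega
  -- `3 ∣ N(E)` (additive) splits in `K`; hence `3 ∤ #𝓞_K^×`
  have h3N : 3 ∣ W.conductorNorm ℤ :=
    (W.dvd_conductorNorm_iff_not_hasGoodReductionAtPrime 3).mpr (not_good_of_addv W 3 hO6.2.1)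
  have hsplit : SplitsIn K 3 := hHN 3 Nat.prime_three h3N
  have hwK : ¬ 3 ∣ Units.torsionOrder K :=
    (X11b.Three.not_dvd_discr_and_not_dvd_torsionOrder_of_heegner hK hHN (by decide) h3N).2
  -- the Heegner point over `K` and its data; non-torsion by Gross–Zagier
  obtain ⟨P, Dt, H, ι, hP⟩ := hHP W K hK hHN
  have hL0 : W.entireLFunction 1 = 0 := entireLFunction_one_eq_zero_of_analyticRank_eq_one hr
  obtain ⟨-, hderiv⟩ := leadingLCoeff_eq_deriv_of_analyticRank_eq_one hr
  have hLK : LDerivEK W K ≠ 0 := by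
    rw [lDerivEK_eq_deriv_mul W K hmod hL0]; exact mul_ne_zero hderiv hLt
  have hnt : ¬ IsOfFinAddOrder P :=
    (lDerivEK_ne_zero_iff_not_isOfFinAddOrder W (W.conductorNorm ℤ) K (hGZ _ W K) hK hHN
      ⟨Dt, H, ι, hP⟩).mp hLK
  -- Kolyvagin: `rank E(K) = 1`, `Ш(E/K)` finite
  obtain ⟨hrk, hfin⟩ := hKo (W.conductorNorm ℤ) W K hK hHN ⟨Dt, H, ι, hP⟩ hnt
  -- a frame `(κ, γ, 𝔭)` and the other prime `𝔭′ ≠ 𝔭` above `3`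
  obtain ⟨κ, γ, -, hκ, hγ, -⟩ := X11b.exists_anticyclotomic_generator_prime (p := 3) hK
  haveI : Fact (κ.IsTopGenerator γ) := ⟨hγ⟩
  obtain ⟨𝔭, h𝔭, he, hf⟩ := X11b.exists_degreeOnePrime_of_splitsIn K 3 hK.1 hsplit
  obtain ⟨𝔭', hne, h𝔭', he', hf'⟩ := X11b.Three.exists_ne_degreeOne_prime hK.1 h𝔭 he hf
  -- (b) PLUMBING. Waldspurger frame and unit value at `(κ, γ, 𝔭)`
  obtain ⟨ι', hind, ΩK, Ωp, L, hΩK, hΩp, hBDP, u, hval⟩ :=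
    hV W (W.conductorNorm ℤ) K Dt H ι P hO6 hsurj hr rfl hK hHN hLt hP hnt κ hκ γ 𝔭 h𝔭 he hf
  -- control count at `𝔭′` (CTL₀ included; supplies the torsion guard of the Eisenstein crux)
  have hctl : SchneiderFree.AdditiveControlOnTreeAt 3 κ 𝔭' γ (embAt K 3 𝔭' h𝔭' he' hf') P :=
    hC W (W.conductorNorm ℤ) K Dt H ι P hO6 hsurj hr rfl hK hHN hLt hP hnt (hKo _ W K) κ hκ γ 𝔭'
      h𝔭' he' hf'
  obtain ⟨n, hn, hneq⟩ := hctl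
  -- the EISENSTEIN INCLUSION `Ch_Λ(X_(∅,0))·R₀⟦T⟧ ⊆ (L)` at the frame (the crux, torsion-guarded)
  have hincl : (XAc.charIdeal (W.baseChange K) 3 κ 𝔭' ∅ γ).map (PowerSeries.map (toUnr 3)) ≤
      Ideal.span {L} :=
    hE W (W.conductorNorm ℤ) K Dt hO6 hsurj hr rfl hK hHN κ hκ γ 𝔭 h𝔭 he hf 𝔭' h𝔭' hne ι' hind
      ΩK Ωp L hΩK hΩp hBDP hn.1
  -- the value read through the logarithm at `𝔭′` (rank one: `(log_{𝔭′} P)² = (log_𝔭 P)²`)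
  have hval' : L.HasValueAt 0 ((((u : unrIntegers 3) : unrIntegers 3) : ℂ_[3]) *
      (algebraMap ℚ_[3] ℂ_[3]
        (logOmega W 3 (embAt K 3 𝔭' h𝔭' he' hf') P / (Dt.c : ℚ_[3]))) ^ 2) :=
    (SchneiderFreeAdditiveX3.hasValueAt_sq_logOmega_embAt_iff_of_rank_one W 3 hK.1 hrk h𝔭 he hf
      h𝔭' he' hf' P _ _ L).mpr hval
  -- the LOWER socket at slack `v₃(c)` at the frame `(κ, 𝔭′, γ, embAt 𝔭′)`
  have hc0 : Dt.c ≠ 0 := Dt.maninConstant_ne_zero_holds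
  have hlog : logOmega W 3 (embAt K 3 𝔭' h𝔭' he' hf') P ≠ 0 := X11b.R1.logOmega_ne_zero W 3 _ hnt
  have hlow : SchneiderFree.AdditiveIMCLowerBDPOnTreeLeAt 3 κ 𝔭' γ (embAt K 3 𝔭' h𝔭' he' hf')
      (padicValNat 3 Dt.c.natAbs) P := by
    -- the LOWER norm receptacle (`⊆` + value): `2·ord₃(log_{𝔭′}P / c) ≤ ord₃ f(0)`
    obtain ⟨htors, f, hfI, hf0, hfn⟩ := hn
    have hmem : PowerSeries.map (toUnr 3) f ∈ Ideal.span {L} := by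
      have h3 := hincl
      rw [hfI, CongruenceLimit.map_span_singleton_powerSeries] at h3
      exact (Ideal.span_singleton_le_iff_mem _).mp h3
    obtain ⟨-, hle⟩ := Supersingular.two_mul_valuation_le_of_mem_span 3 hf0 hmem u hval'
    have hc0' : (Dt.c : ℚ_[3]) ≠ 0 := by exact_mod_cast hc0
    rw [div_eq_mul_inv, Padic.valuation_mul hlog (inv_ne_zero hc0'), Padic.valuation_inv,
      Padic.valuation_intCast, valuation_logOmega hlog, hfn] at hle
    refine ⟨n, ⟨htors, f, hfI, hf0, hfn⟩, ?_⟩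
    simp only [padicValInt] at hle
    linarith
  -- STEP L at slack `v₃(c)`
  have hlo : SchneiderFree.IndexLowerBoundLeAt W 3 K P (padicValNat 3 Dt.c.natAbs) :=
    SchneiderFreeAdditiveX3.indexLowerBoundLeAt_of_imcLowerLe_of_control rfl hK hHN hfin hlow
      ⟨n, hn, hneq⟩
  -- (c) a globally minimal model of the twist; its UPPER half from the rank-zero wild leaf
  have hD0 : (NumberField.discr K : ℚ) ≠ 0 := by exact_mod_cast NumberField.discr_ne_zero K
  haveI : (W.quadraticTwist (NumberField.discr K : ℚ)).IsElliptic := W.isElliptic_quadraticTwist hD0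
  obtain ⟨Cd, hCd⟩ := hasGlobalMinimalModel_rat_holds (W.quadraticTwist (NumberField.discr K : ℚ))
  haveI : (Cd • W.quadraticTwist (NumberField.discr K : ℚ)).IsGloballyMinimal := hCd
  have hdup : MissingUpperBoundAt (Cd • W.quadraticTwist (NumberField.discr K : ℚ)) 3 :=
    twist_upperHalf_of_rankZeroLeaf hGZK hZ W hO6 hsurj K hK hodd hHN hLt
      (Cd • W.quadraticTwist (NumberField.discr K : ℚ)) Cd rfl
  -- JOINT lower half over the pair, then descend with the twist's upper half
  exact missingLowerBoundAt_of_joint_of_upper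
    (SchneiderFree.Exact.jointLowerBoundAt_of_stepL_manin hGZ hKo hGZK hmod hGZ73 W 3 (W.conductorNorm ℤ)
      K Dt H ι P (Cd • W.quadraticTwist (NumberField.discr K : ℚ)) hr rfl h3N hK hodd hwK hHN hLt hP
      ⟨Cd, rfl⟩ (by decide) hlo) hdup

/-! ### §2 Route `CyclotomicUntwist`, deciding crux K1 BY NAME -/

/-- **CU's deciding crux K1 `PSRankOneLowerHalfAtThree` (stmt-BirchSwinnertonDyer-21580) from SOED's published
inputs, Eisenstein crux E (20479), Waldspurger V (20385), control C (20386) and rank-zero wild leaf Z (20387).**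
The principal-series binders of K1 (`v₃(Δ_min)` even, `Δ_min/3^v ≡ 1 (mod 3)`) and `¬ HasCM` are not used:
the supply is the whole onto wild rank-one leaf (§1). CONDITIONAL cross-route kernel; closes nothing; BSD is
not proved by this. [cite: JetchevSkinnerWan2017, §7.4.1 (arXiv:1512.06894 p. 30)]
[cite: Castella2018, Thm. 2.3 and §5 (5.1)–(5.3)] [cite: GrossZagier1986, Thm. I.(6.3) and V.§2]
[cite: FriedbergHoffstein1995, Thm. B] -/
theorem psRankOneLowerHalfAtThree_of_soed (hF : PublishedInputsWildThree)
    (hE : WildSplitEisensteinInclusionAtThree) (hV : WildSplitWaldspurgerAtThree)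
    (hC : WildSplitControlAtThree) (hZ : WildRankZeroTwistAtThree) :
    Summit.BirchSwinnertonDyer.BirchSwinnertonDyer.Theses.CyclotomicUntwist.PSRankOneLowerHalfAtThree := by
  intro W _ _ _hncm hO6 hsurj _hev _hsq hr
  exact lowerHalf_of_eisenstein_of_waldspurger_of_control_of_rankZeroLeaf hF hE hV hC hZ W hO6 hsurj hr

/-! ### §3 (appended) The K1 birth line's registered stubs 2–3, in THEIR binders, modulo SOED -/

/-- **The K1 birth line's `stub_rung_lowerHalfOnGNine_towerUnit` (BC5 first rung), VERBATIM binders, modulo SOED's published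
inputs ∧ E ∧ V ∧ C ∧ Z** — the (G₉), tower and Tamagawa binders are IDLE in this supply (the Eisenstein road is tower- and
type-blind); the stub's OWN research content is the finite-slope road, an ALTERNATIVE supply. CONDITIONAL helper, not a stub
proof. [cite: JetchevSkinnerWan2017, §7.4.1 (arXiv:1512.06894 p. 30)] [cite: Castella2018, Thm. 2.3 and §5 (5.1)–(5.3)] -/
theorem stub_rung_lowerHalfOnGNine_towerUnit_of_soed (hF : PublishedInputsWildThree)
    (hE : WildSplitEisensteinInclusionAtThree) (hV : WildSplitWaldspurgerAtThree)
    (hC : WildSplitControlAtThree) (hZ : WildRankZeroTwistAtThree) :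
    ∀ (W : WeierstrassCurve ℚ) [W.IsElliptic] [W.IsGloballyMinimal],
      ¬ W.HasCM → ClassO6 W 3 → Surj W 3 → TypeGNine W →
      ((∀ n : ℕ, W.HasSurjectiveModNGaloisRep (3 ^ n : ℕ)) ∧ ¬ 3 ∣ W.tamagawaProduct) →
      W.analyticRank = 1 → MissingLowerBoundAt W 3 := by
  intro W _ _ _hncm hO6 hsurj _hG _hu hr
  exact lowerHalf_of_eisenstein_of_waldspurger_of_control_of_rankZeroLeaf hF hE hV hC hZ W hO6 hsurj hr

/-- **The K1 birth line's `stub_lowerHalfOnGNine_rest`, VERBATIM binders, modulo SOED's published inputs ∧ E ∧ V ∧ C ∧ Z**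
(same supply; the negated tower/Tamagawa binder is idle). CONDITIONAL helper, not a stub proof.
[cite: JetchevSkinnerWan2017, §7.4.1 (arXiv:1512.06894 p. 30)] [cite: Castella2018, Thm. 2.3 and §5 (5.1)–(5.3)] -/
theorem stub_lowerHalfOnGNine_rest_of_soed (hF : PublishedInputsWildThree)
    (hE : WildSplitEisensteinInclusionAtThree) (hV : WildSplitWaldspurgerAtThree)
    (hC : WildSplitControlAtThree) (hZ : WildRankZeroTwistAtThree) :
    ∀ (W : WeierstrassCurve ℚ) [W.IsElliptic] [W.IsGloballyMinimal],
      ¬ W.HasCM → ClassO6 W 3 → Surj W 3 → TypeGNine W →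
      ¬ ((∀ n : ℕ, W.HasSurjectiveModNGaloisRep (3 ^ n : ℕ)) ∧ ¬ 3 ∣ W.tamagawaProduct) →
      W.analyticRank = 1 → MissingLowerBoundAt W 3 := by
  intro W _ _ _hncm hO6 hsurj _hG _hu hr
  exact lowerHalf_of_eisenstein_of_waldspurger_of_control_of_rankZeroLeaf hF hE hV hC hZ W hO6 hsurj hr

/-- **K1's registered composition fed by the conditional supplies of stubs 2–3 and ANY stub 1 (`GNineCriterion`)** — the
birth skeleton's `PSRankOneLowerHalfAtThree_of` shape: stub 1 as a hypothesis, stubs 2–3 from SOED {inputs, E, V, C, Z}.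
(Since the supplies ignore `TypeGNine`, K1 also follows without stub 1: `psRankOneLowerHalfAtThree_of_soed`.) CONDITIONAL.
[cite: JetchevSkinnerWan2017, §7.4.1 (arXiv:1512.06894 p. 30)] -/
theorem psRankOneLowerHalfAtThree_of_gNine_of_stubSupplies
    (h₁ : ∀ (W : WeierstrassCurve ℚ) [W.IsElliptic] [W.IsGloballyMinimal],
      ClassO6 W 3 → Even (padicValInt 3 W.minimalDiscriminantInt) →
      W.minimalDiscriminantInt / 3 ^ padicValInt 3 W.minimalDiscriminantInt % 3 = 1 → TypeGNine W)
    (hF : PublishedInputsWildThree) (hE : WildSplitEisensteinInclusionAtThree) (hV : WildSplitWaldspurgerAtThree)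
    (hC : WildSplitControlAtThree) (hZ : WildRankZeroTwistAtThree) :
    Summit.BirchSwinnertonDyer.BirchSwinnertonDyer.Theses.CyclotomicUntwist.PSRankOneLowerHalfAtThree := by
  intro W _ _ hncm hO6 hsurj hev hsq hr
  have hG : TypeGNine W := h₁ W hO6 hev hsq
  by_cases hu : ((∀ n : ℕ, W.HasSurjectiveModNGaloisRep (3 ^ n : ℕ)) ∧ ¬ 3 ∣ W.tamagawaProduct)
  · exact stub_rung_lowerHalfOnGNine_towerUnit_of_soed hF hE hV hC hZ W hncm hO6 hsurj hG hu hr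
  · exact stub_lowerHalfOnGNine_rest_of_soed hF hE hV hC hZ W hncm hO6 hsurj hG hu hr

end Summit.BirchSwinnertonDyer.BirchSwinnertonDyer.Theorems.CyclotomicUntwistOfSOED

end
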